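import Summits.KontsevichZagierPeriods.KontsevichZagierPeriods.Theorems.RootDecompQuadraticDescentPair18HomotopyAngP06

/-! # `RootDecompQuadraticDescentPair18HomotopyAngP07` — part 7/20 of the mechanical ≤400-line split of `Pair18HomotopyAng_v13_landing.lean` (sha256 01bf0af4c8d09f43…)
Source: decomp-kz lens-6 g9 `Pair18HomotopyAng.lean` v13 (HOME/decomp-kz-lens-6/g9/, sha256 bd7fcda1…; critic g5 19:35:56Z CLEARED «angle side of #18 PROVED»: hTh7_holds, hB17_holds, hAng4_holds with no hypotheses) — companion file #2 of Pair18Homotopy v14 (landed as …Pair18HomotopyP01–P31): the verbatim COPIED PRELUDE is dropped in favour of those landed declarations, the four homonyms with different bodies are renamed (Th7_eq', TriA, isSemialgebraic_TriA, volume_diag'), `#print axioms` pins removed.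
Split by census-1 g9 `gen/splitlean.py`: scopes re-opened with their `open`/`variable`/`set_option` context; mathematics and declaration order unchanged. -/

set_option linter.unusedSimpArgs false
noncomputable section
open _root_.Set MvPolynomial
namespace Summit.KontsevichZagierPeriods.RootDecompQuadraticDescent.Pair18Homotopy
open Literature.NumberTheory.Transcendental
open Literature.NumberTheory.Transcendental.KZ (RFun cube)
open Summit.KontsevichZagierPeriods.RootDecompQuadraticDescent.DarkPairs (rel_reflect_rep rel_double)
section Fold
open Literature.ModelTheory.ExponentialFields (IsSemialgebraic isSemialgebraic_setOf_eval_le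
  isSemialgebraic_setOf_eval_pos isSemialgebraic_setOf_eval_nonneg isSemialgebraic_setOf_eval_eq_zero)

open _root_.Set MvPolynomial in
open Literature.NumberTheory.Transcendental in
open Literature.NumberTheory.Transcendental.KZ (RFun cube) in
open Summit.KontsevichZagierPeriods.RootDecompQuadraticDescent.DarkPairs (rel_reflect_rep rel_double) in
/-- Auxiliary step `vec2_1` (§2b): vec2 1. [bookkeeping] -/
private theorem vec2_1 (a b : ℝ) : (![a, b] : Fin 2 → ℝ) 1 = b := rfl

open _root_.Set MvPolynomial in
open Literature.NumberTheory.Transcendental in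
open Literature.NumberTheory.Transcendental.KZ (RFun cube) in
open Summit.KontsevichZagierPeriods.RootDecompQuadraticDescent.DarkPairs (rel_reflect_rep rel_double) in
/-- Auxiliary step `vec2_0` (§2b): vec2 0. [bookkeeping] -/
private theorem vec2_0 (a b : ℝ) : (![a, b] : Fin 2 → ℝ) 0 = a := rfl

open _root_.Set MvPolynomial in
open Literature.NumberTheory.Transcendental in
open Literature.NumberTheory.Transcendental.KZ (RFun cube) in
open Summit.KontsevichZagierPeriods.RootDecompQuadraticDescent.DarkPairs (rel_reflect_rep rel_double) in
/-- Auxiliary step `cube2` (§0): cube2. [bookkeeping] -/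
private theorem cube2 {x : Fin 2 → ℝ} (hx : x ∈ KZ.cube 2) : (0 ≤ x 0 ∧ x 0 ≤ 1) ∧ (0 ≤ x 1 ∧ x 1 ≤ 1) := ⟨hx 0, hx 1⟩

/-! ### §19h  hAng4, fourth transport: cut `[AngH | RM]` at `Q = 0` and at `9Q² = 7` (`ψ = 2α₁`), and invert
the cap, `Q' = 1/Q`

`RM = {1 ≤ 7P² ≤ 9, −P ≤ Q, Q² ≤ 1+2P²}` spans `ψ ∈ [−φ, ½π − κ'(φ)]`, too tall for one bounded chart after
the shear.  Cut at `Q = 0` (`RM⁻ = {−P ≤ Q ≤ 0}`, a LINE polygon, reflected to `{0 ≤ ψ ≤ φ}` in g10) and cut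
`RM⁺ = RM ∩ {Q ≥ 0}` at `9Q² = 7`, i.e. `ψ = 2α₁` (`tan 2α₁ = √7/3`; a LATTICE angle — this is the point of the
choice: every cell below ends up with vertices in the lattice `ℤα₁ + ℤθ`, no `π/4`): the low part
`RM_rect = {1 ≤ 7P² ≤ 9, 0 ≤ Q, 9Q² ≤ 7}` is the lattice rectangle `[α₁, θ−α₁] × [0, 2α₁]`, and the cap
`{9Q² ≥ 7}` is carried by the inversion `(P,Q) ↦ (P, 1/Q)` (`ψ ↦ ½π − ψ`, measure-preserving) onto
`RM_cap' = {1 ≤ 7P² ≤ 9, ½ ≤ Q', 7Q'² ≤ 9, Q'²(1+2P²) ≥ 1}` (`v' ≤ θ − α₁`), bounded below by the SAME straightened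
curve as §19e–§19g. -/

/-- Auxiliary definition `sQn` (§19h): s Qn. [bookkeeping] -/
def sQn : Set (Fin 2 → ℝ) := {z | 4 * z 1 ≤ 2}
/-- Auxiliary definition `sL` (§19h): s L. [bookkeeping] -/
def sL : Set (Fin 2 → ℝ) := {z | 9 * ((4 * z 1 - 2) * (4 * z 1 - 2)) ≤ 7}
/-- Auxiliary definition `sLc` (§19h): s Lc. [bookkeeping] -/
def sLc : Set (Fin 2 → ℝ) := {z | 7 ≤ 9 * ((4 * z 1 - 2) * (4 * z 1 - 2))}
/-- `RM⁻ = RM ∩ {Q ≤ 0}`, `RM⁺ = RM ∩ {Q ≥ 0}`, `RM_rect = RM⁺ ∩ {9Q² ≤ 7}`, `RM⁺ ∩ {9Q² ≥ 7}` (the cap). -/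
def RMneg : Set (Fin 2 → ℝ) := RM ∩ sQn
/-- Auxiliary definition `RMpos` (§19h): RMpos. [bookkeeping] -/
def RMpos : Set (Fin 2 → ℝ) := RM ∩ sU1
/-- Auxiliary definition `RMrect` (§19h): RMrect. [bookkeeping] -/
def RMrect : Set (Fin 2 → ℝ) := RMpos ∩ sL
/-- Auxiliary definition `RMcap` (§19h): RMcap. [bookkeeping] -/
def RMcap : Set (Fin 2 → ℝ) := RMpos ∩ sLc
/-- Auxiliary step `isSemialgebraic_RMneg` (§19h): is Semialgebraic RMneg. [bookkeeping] -/
theorem isSemialgebraic_RMneg : IsSemialgebraic ℚ RMneg :=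
  isSemialgebraic_RM.inter (isSemialgebraic_of_le (C 4 * X 1) (C 2) sQn fun z => by
    simp only [sQn, mem_setOf_eq, map_mul, aeval_C, aeval_X, eq_ratCast, Rat.cast_ofNat])
/-- Auxiliary step `isSemialgebraic_RMpos` (§19h): is Semialgebraic RMpos. [bookkeeping] -/
theorem isSemialgebraic_RMpos : IsSemialgebraic ℚ RMpos :=
  isSemialgebraic_RM.inter (isSemialgebraic_of_le (C 2) (C 4 * X 1) sU1 fun z => by
    simp only [sU1, mem_setOf_eq, map_mul, aeval_C, aeval_X, eq_ratCast, Rat.cast_ofNat])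
/-- Auxiliary step `isSemialgebraic_RMrect` (§19h): is Semialgebraic RMrect. [bookkeeping] -/
theorem isSemialgebraic_RMrect : IsSemialgebraic ℚ RMrect :=
  isSemialgebraic_RMpos.inter (isSemialgebraic_of_le (C 9 * ((C 4 * X 1 - C 2) * (C 4 * X 1 - C 2))) (C 7) sL
    fun z => by
    simp only [sL, mem_setOf_eq, map_mul, map_sub, aeval_C, aeval_X, eq_ratCast, Rat.cast_ofNat])
/-- Auxiliary step `isSemialgebraic_RMcap` (§19h): is Semialgebraic RMcap. [bookkeeping] -/
theorem isSemialgebraic_RMcap : IsSemialgebraic ℚ RMcap :=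
  isSemialgebraic_RMpos.inter (isSemialgebraic_of_le (C 7) (C 9 * ((C 4 * X 1 - C 2) * (C 4 * X 1 - C 2))) sLc
    fun z => by
    simp only [sLc, mem_setOf_eq, map_mul, map_sub, aeval_C, aeval_X, eq_ratCast, Rat.cast_ofNat])
/-- Auxiliary definition `AngHMneg` (§19h): Ang HMneg. [bookkeeping] -/
def AngHMneg : KZ.IntegralRep 2 := AngH.rep.restrict RMneg isSemialgebraic_RMneg (fun _ hz => hz.1.1)
/-- Auxiliary definition `AngHMpos` (§19h): Ang HMpos. [bookkeeping] -/
def AngHMpos : KZ.IntegralRep 2 := AngH.rep.restrict RMpos isSemialgebraic_RMpos (fun _ hz => hz.1.1)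
/-- Auxiliary definition `AngHMrect` (§19h): Ang HMrect. [bookkeeping] -/
def AngHMrect : KZ.IntegralRep 2 := AngH.rep.restrict RMrect isSemialgebraic_RMrect (fun _ hz => hz.1.1.1)
/-- Auxiliary definition `AngHMcap` (§19h): Ang HMcap. [bookkeeping] -/
def AngHMcap : KZ.IntegralRep 2 := AngH.rep.restrict RMcap isSemialgebraic_RMcap (fun _ hz => hz.1.1.1)

/-- the null-line cut `[AngH | RM] ≡ [AngH | RM ∩ {Q ≤ 0}] + [AngH | RM ∩ {Q ≥ 0}]`. -/
theorem AngHM_cut0 : KZ.of AngHM - KZ.of AngHMneg - KZ.of AngHMpos ∈ KZ.relations := by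
  have hnull : MeasureTheory.volume {z : Fin 2 → ℝ | 4 * z 1 = 2} = 0 := by
    have h := volume_setOf_aeval_eq_zero (k := ℚ) (m := 2) (C 4 * X 1 - C 2 : MvPolynomial (Fin 2) ℚ) (by
      intro h0
      have h1 := congr_arg (MvPolynomial.eval (fun _ => (0:ℝ))) h0
      simp at h1)
    have e : {x : Fin 2 → ℝ | aeval x (C 4 * X 1 - C 2 : MvPolynomial (Fin 2) ℚ) = 0} =
        {z : Fin 2 → ℝ | 4 * z 1 = 2} := by
      ext z
      simp only [mem_setOf_eq, map_sub, map_mul, aeval_C, aeval_X, eq_ratCast, Rat.cast_ofNat, sub_eq_zero]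
    rw [← e]; exact h
  exact rel_cut AngHM AngHMneg AngHMpos (fun z => 4 * z 1) 2 rfl rfl hnull (fun _ _ => rfl) (fun _ _ => rfl)

/-- the null-curve cut `[AngH | RM⁺] ≡ [AngH | RM⁺ ∩ {9Q² ≤ 7}] + [AngH | RM⁺ ∩ {9Q² ≥ 7}]`. -/
theorem AngHMpos_cut : KZ.of AngHMpos - KZ.of AngHMrect - KZ.of AngHMcap ∈ KZ.relations := by
  have hnull : MeasureTheory.volume {z : Fin 2 → ℝ | 9 * ((4 * z 1 - 2) * (4 * z 1 - 2)) = 7} = 0 := by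
    have h := volume_setOf_aeval_eq_zero (k := ℚ) (m := 2)
      (C 9 * ((C 4 * X 1 - C 2) * (C 4 * X 1 - C 2)) - C 7 : MvPolynomial (Fin 2) ℚ) (by
      intro h0
      have h1 := congr_arg (MvPolynomial.eval (fun _ => (0:ℝ))) h0
      simp at h1
      norm_num at h1)
    have e : {x : Fin 2 → ℝ | aeval x (C 9 * ((C 4 * X 1 - C 2) * (C 4 * X 1 - C 2)) - C 7 :
        MvPolynomial (Fin 2) ℚ) = 0} = {z : Fin 2 → ℝ | 9 * ((4 * z 1 - 2) * (4 * z 1 - 2)) = 7} := by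
      ext z
      simp only [mem_setOf_eq, map_sub, map_mul, aeval_C, aeval_X, eq_ratCast, Rat.cast_ofNat, sub_eq_zero]
    rw [← e]; exact h
  exact rel_cut AngHMpos AngHMrect AngHMcap (fun z => 9 * ((4 * z 1 - 2) * (4 * z 1 - 2))) 7 rfl rfl hnull
    (fun _ _ => rfl) (fun _ _ => rfl)

/-- Auxiliary definition `sI3` (§19h): s I3. [bookkeeping] -/
def sI3 : Set (Fin 2 → ℝ) := {z | 7 * ((4 * z 1 - 2) * (4 * z 1 - 2)) ≤ 9}
/-- Auxiliary definition `sI4` (§19h): s I4. [bookkeeping] -/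
def sI4 : Set (Fin 2 → ℝ) := {z | 1 ≤ (4 * z 1 - 2) * (4 * z 1 - 2) * (8 * z 0 * z 0 + 1)}
/-- Auxiliary definition `sI5` (§19h): s I5. [bookkeeping] -/
def sI5 : Set (Fin 2 → ℝ) := {z | 5 ≤ 8 * z 1}
/-- `RM_cap' = {1 ≤ 7P² ≤ 9, ½ ≤ Q', 7Q'² ≤ 9, Q'²(1+2P²) ≥ 1}` in `P = 2s`, `Q' = 4w − 2`. -/
def RMcapI : Set (Fin 2 → ℝ) := cube 2 ∩ (sRM1 ∩ sRM2 ∩ sI3 ∩ sI4 ∩ sI5)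
/-- Auxiliary step `isSemialgebraic_RMcapI` (§19h): is Semialgebraic RMcap I. [bookkeeping] -/
theorem isSemialgebraic_RMcapI : IsSemialgebraic ℚ RMcapI := by
  refine KZ.isSemialgebraic_cube.inter (((((?_ : IsSemialgebraic ℚ sRM1).inter ?_).inter ?_).inter ?_).inter ?_)
  · exact isSemialgebraic_of_le (C 1) (C 28 * X 0 * X 0) sRM1 fun z => by
      simp only [sRM1, mem_setOf_eq, map_mul, aeval_C, aeval_X, eq_ratCast, Rat.cast_ofNat, Rat.cast_one]
  · exact isSemialgebraic_of_le (C 28 * X 0 * X 0) (C 9) sRM2 fun z => by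
      simp only [sRM2, mem_setOf_eq, map_mul, aeval_C, aeval_X, eq_ratCast, Rat.cast_ofNat, Rat.cast_one]
  · exact isSemialgebraic_of_le (C 7 * ((C 4 * X 1 - C 2) * (C 4 * X 1 - C 2))) (C 9) sI3 fun z => by
      simp only [sI3, mem_setOf_eq, map_mul, map_sub, aeval_C, aeval_X, eq_ratCast, Rat.cast_ofNat]
  · exact isSemialgebraic_of_le (C 1) ((C 4 * X 1 - C 2) * (C 4 * X 1 - C 2) * (C 8 * X 0 * X 0 + C 1)) sI4
      fun z => by
      simp only [sI4, mem_setOf_eq, map_mul, map_sub, map_add, aeval_C, aeval_X, eq_ratCast, Rat.cast_ofNat,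
        Rat.cast_one]
  · exact isSemialgebraic_of_le (C 5) (C 8 * X 1) sI5 fun z => by
      simp only [sI5, mem_setOf_eq, map_mul, aeval_C, aeval_X, eq_ratCast, Rat.cast_ofNat]
/-- `[AngH | RM_cap']`. -/
def AngHMcapI : KZ.IntegralRep 2 := AngH.rep.restrict RMcapI isSemialgebraic_RMcapI (fun _ hz => hz.1)

/-- Auxiliary step `RMcap_facts` (§19h): RMcap facts. [bookkeeping] -/
theorem RMcap_facts (z : Fin 2 → ℝ) (hz : z ∈ RMcap) :
    (0 ≤ z 0 ∧ z 0 ≤ 1) ∧ (0 ≤ z 1 ∧ z 1 ≤ 1) ∧ 1 ≤ 28 * z 0 * z 0 ∧ 28 * z 0 * z 0 ≤ 9 ∧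
      (4 * z 1 - 2) * (4 * z 1 - 2) ≤ 8 * z 0 * z 0 + 1 ∧ 2 ≤ 4 * z 1 ∧
      7 ≤ 9 * ((4 * z 1 - 2) * (4 * z 1 - 2)) := by
  obtain ⟨⟨⟨hc, ⟨⟨⟨h1, h2⟩, -⟩, h4⟩⟩, h5⟩, h6⟩ := hz
  exact ⟨(cube2 hc).1, (cube2 hc).2, h1, h2, h4, h5, h6⟩
/-- on the cap `Q > ½` (from `Q ≥ 0` and `9Q² ≥ 7`). -/
theorem RMcap_Q (z : Fin 2 → ℝ) (hz : z ∈ RMcap) : 1 / 2 < 4 * z 1 - 2 := by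
  obtain ⟨-, -, -, -, -, hV, hL⟩ := RMcap_facts z hz
  by_contra h
  have h' := not_lt.mp h
  nlinarith [mul_nonneg (sub_nonneg.2 h') (by linarith : (0:ℝ) ≤ 4 * z 1 - 2)]
/-- Auxiliary step `RMcapI_facts` (§19h): RMcap I facts. [bookkeeping] -/
theorem RMcapI_facts (z : Fin 2 → ℝ) (hz : z ∈ RMcapI) :
    (0 ≤ z 0 ∧ z 0 ≤ 1) ∧ (0 ≤ z 1 ∧ z 1 ≤ 1) ∧ 1 ≤ 28 * z 0 * z 0 ∧ 28 * z 0 * z 0 ≤ 9 ∧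
      7 * ((4 * z 1 - 2) * (4 * z 1 - 2)) ≤ 9 ∧
      1 ≤ (4 * z 1 - 2) * (4 * z 1 - 2) * (8 * z 0 * z 0 + 1) ∧ 5 ≤ 8 * z 1 := by
  obtain ⟨hc, ⟨⟨⟨⟨h1, h2⟩, h3⟩, h4⟩, h5⟩⟩ := hz
  exact ⟨(cube2 hc).1, (cube2 hc).2, h1, h2, h3, h4, h5⟩

set_option maxHeartbeats 1600000 in
/-- **`[AngH | RM⁺ ∩ {9Q² ≥ 7}] ≡ [AngH | RM_cap']`** by the inversion `Φ(s,w) = (s, (1 + 2(4w−2))/(4(4w−2)))`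
(`Q' = 1/Q`, `|det DΦ| = 1/Q²`, `(1+Q²)·Q'² = 1 + Q'²`). -/
theorem AngHMcap_inv : KZ.of AngHMcap - KZ.of AngHMcapI ∈ KZ.relations := by
  let Φ : (Fin 2 → ℝ) → (Fin 2 → ℝ) := fun z => ![z 0, (1 + 2 * (4 * z 1 - 2)) / (4 * (4 * z 1 - 2))]
  let M11 : (Fin 2 → ℝ) → ℝ := fun z => -1 / ((4 * z 1 - 2) * (4 * z 1 - 2))
  let Mz : (Fin 2 → ℝ) → Matrix (Fin 2) (Fin 2) ℝ := fun z => !![1, 0; 0, M11 z]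
  let Φ' : (Fin 2 → ℝ) → (Fin 2 → ℝ) →L[ℝ] (Fin 2 → ℝ) := fun z =>
    LinearMap.toContinuousLinearMap (Matrix.toLin' (Mz z))
  have hΦ'ap : ∀ z w, Φ' z w = ![w 0, M11 z * w 1] := by
    intro z w; funext i
    fin_cases i <;> simp [Φ', Mz, Matrix.toLin'_apply, Matrix.mulVec, dotProduct, Fin.sum_univ_two]
  have hdet : ∀ z, (Φ' z).det = M11 z := by
    intro z
    unfold ContinuousLinearMap.det
    simp [Φ', LinearMap.det_toLin', Mz, Matrix.det_fin_two]
  have hΦ0 : ∀ z, Φ z 0 = z 0 := fun z => rfl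
  have hΦ1 : ∀ z, Φ z 1 = (1 + 2 * (4 * z 1 - 2)) / (4 * (4 * z 1 - 2)) := fun z => rfl
  have hdom : AngHMcapI.domain = Φ '' AngHMcap.domain := by
    simp only [AngHMcapI, AngHMcap, KZ.IntegralRep.domain_restrict, RFun.rep_domain]
    ext w
    constructor
    · intro hw
      obtain ⟨hw0, hw1, r1, r2, i3, i4, i5⟩ := RMcapI_facts w hw
      have hG : (1:ℝ) / 2 ≤ 4 * w 1 - 2 := by linarith
      have hGp : (0:ℝ) < 4 * w 1 - 2 := by linarith
      set b : ℝ := (1 + 2 * (4 * w 1 - 2)) / (4 * (4 * w 1 - 2)) with hb_def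
      have hb4 : 4 * b - 2 = 1 / (4 * w 1 - 2) := by
        rw [hb_def]
        generalize hGG : 4 * w 1 - 2 = G at *
        have hGne : G ≠ 0 := hGp.ne'
        field_simp
        ring
      have hb2 : 2 ≤ 4 * b := by
        have : 0 ≤ 1 / (4 * w 1 - 2) := (one_div_pos.2 hGp).le
        linarith [hb4]
      have hb1 : b ≤ 1 := by
        have : 1 / (4 * w 1 - 2) ≤ 2 := by rw [div_le_iff₀ hGp]; linarith
        linarith [hb4]
      have hbL : 7 ≤ 9 * ((4 * b - 2) * (4 * b - 2)) := by
        rw [hb4, div_mul_div_comm, one_mul, mul_one_div, le_div_iff₀ (mul_pos hGp hGp)]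
        linarith [i3]
      refine ⟨![w 0, b], ⟨⟨⟨?_, ⟨⟨⟨?_, ?_⟩, ?_⟩, ?_⟩⟩, ?_⟩, ?_⟩, ?_⟩
      · intro i
        fin_cases i
        · simp only [Fin.zero_eta, Matrix.cons_val_zero]; exact hw0
        · simp only [Fin.mk_one, Matrix.cons_val_one, Matrix.head_cons, Matrix.cons_val_fin_one]
          constructor <;> linarith
      · simp only [sRM1, mem_setOf_eq, Matrix.cons_val_zero]; exact r1
      · simp only [sRM2, mem_setOf_eq, Matrix.cons_val_zero]; exact r2
      · simp only [sRM3, mem_setOf_eq, Matrix.cons_val_zero, Matrix.cons_val_one, Matrix.head_cons,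
          Matrix.cons_val_fin_one]
        linarith [hw0.1]
      · simp only [sRM4, mem_setOf_eq, Matrix.cons_val_zero, Matrix.cons_val_one, Matrix.head_cons,
          Matrix.cons_val_fin_one]
        rw [hb4, div_mul_div_comm, one_mul, div_le_iff₀ (mul_pos hGp hGp)]
        nlinarith [i4]
      · show 2 ≤ 4 * (![w 0, b] 1)
        simp only [Matrix.cons_val_one, Matrix.head_cons, Matrix.cons_val_fin_one]; exact hb2
      · show 7 ≤ 9 * ((4 * (![w 0, b] 1) - 2) * (4 * (![w 0, b] 1) - 2))
        simp only [Matrix.cons_val_one, Matrix.head_cons, Matrix.cons_val_fin_one]; exact hbL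
      · funext i
        fin_cases i
        · simp only [Φ, Fin.zero_eta, Matrix.cons_val_zero]
        · simp only [Φ, Fin.mk_one, Matrix.cons_val_one, Matrix.head_cons, Matrix.cons_val_fin_one]
          rw [hb4]
          generalize hGG : 4 * w 1 - 2 = G at *
          have hGne : G ≠ 0 := hGp.ne'
          field_simp
          rw [← hGG]
          ring
    · rintro ⟨z, hz, rfl⟩
      obtain ⟨h0, h1, r1, r2, r4, hV, hL⟩ := RMcap_facts z hz
      have hGh := RMcap_Q z hz
      have hGp : (0:ℝ) < 4 * z 1 - 2 := by linarith
      have hQ' : 4 * ((1 + 2 * (4 * z 1 - 2)) / (4 * (4 * z 1 - 2))) - 2 = 1 / (4 * z 1 - 2) := by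
        generalize hGG : 4 * z 1 - 2 = G at *
        have hGne : G ≠ 0 := hGp.ne'
        field_simp
        ring
      have hQ'ge : 1 / 2 ≤ 1 / (4 * z 1 - 2) := by
        rw [le_div_iff₀ hGp]; linarith
      refine ⟨fun i => ?_, ⟨⟨⟨⟨?_, ?_⟩, ?_⟩, ?_⟩, ?_⟩⟩
      · fin_cases i
        · simp only [Φ, Fin.zero_eta, Matrix.cons_val_zero]; exact h0
        · simp only [Φ, Fin.mk_one, Matrix.cons_val_one, Matrix.head_cons, Matrix.cons_val_fin_one]
          constructor
          · exact div_nonneg (by linarith) (by linarith)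
          · rw [div_le_one (by linarith)]; linarith
      · simp only [sRM1, mem_setOf_eq, Φ, Matrix.cons_val_zero]; exact r1
      · simp only [sRM2, mem_setOf_eq, Φ, Matrix.cons_val_zero]; exact r2
      · simp only [sI3, mem_setOf_eq, Φ, Matrix.cons_val_one, Matrix.head_cons, Matrix.cons_val_fin_one]
        rw [hQ', div_mul_div_comm, one_mul, mul_one_div, div_le_iff₀ (mul_pos hGp hGp)]
        linarith [hL]
      · simp only [sI4, mem_setOf_eq, Φ, Matrix.cons_val_zero, Matrix.cons_val_one, Matrix.head_cons,
          Matrix.cons_val_fin_one]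
        rw [hQ', div_mul_div_comm, one_mul, div_mul_eq_mul_div, one_mul, le_div_iff₀ (mul_pos hGp hGp)]
        nlinarith [r4]
      · simp only [sI5, mem_setOf_eq, Φ, Matrix.cons_val_one, Matrix.head_cons, Matrix.cons_val_fin_one]
        linarith [hQ', hQ'ge]
  refine KZ.changeOfVariablesRel_subset_relations ⟨2, AngHMcap, AngHMcapI, Φ, Φ', ?_, ?_, ?_, hdom, ?_, rfl⟩
  · have hsd : IsSemialgebraic ℚ AngHMcap.domain := AngHMcap.isSemialgebraic_domain
    refine (isSemialgebraicMapOn_iff_forall_holds hsd).mpr fun i => ?_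
    fin_cases i
    · exact (isSemialgebraicFunOn_aeval hsd (X 0)).congr fun z _ => by
        simp only [Φ, Fin.zero_eta, Matrix.cons_val_zero, aeval_X]
    · refine (isSemialgebraicFunOn_aeval_div_aeval hsd (C 1 + C 2 * (C 4 * X 1 - C 2)) (C 4 * (C 4 * X 1 - C 2))
          fun z hz => ?_).congr fun z _ => ?_
      · have hz' : z ∈ RMcap := by simpa [AngHMcap, KZ.IntegralRep.domain_restrict] using hz
        have hV := RMcap_Q z hz'
        simp only [map_add, map_sub, map_mul, aeval_C, aeval_X, eq_ratCast, Rat.cast_ofNat, Rat.cast_one]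
        linarith
      · simp only [Φ, Fin.mk_one, Matrix.cons_val_one, Matrix.head_cons, Matrix.cons_val_fin_one, map_add,
          map_sub, map_mul, aeval_C, aeval_X, eq_ratCast, Rat.cast_ofNat, Rat.cast_one]
  · intro z hz
    have hz' : z ∈ RMcap := by simpa [AngHMcap, KZ.IntegralRep.domain_restrict] using hz
    obtain ⟨h0, h1, r1, r2, r4, hV, hL⟩ := RMcap_facts z hz'
    have hGp : (0:ℝ) < 4 * z 1 - 2 := by linarith [RMcap_Q z hz']
    have hGne : (4 * z 1 - 2) ≠ 0 := hGp.ne'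
    have h4Gne : 4 * (4 * z 1 - 2) ≠ 0 := mul_ne_zero (by norm_num) hGne
    have hA := hasFDerivAt_apply (𝕜 := ℝ) 0 z
    have hB := hasFDerivAt_apply (𝕜 := ℝ) 1 z
    have hG := (hB.const_mul (4:ℝ)).sub_const (2:ℝ)
    have hNum := (hG.const_mul (2:ℝ)).const_add (1:ℝ)
    have hDen := hG.const_mul (4:ℝ)
    have hinv := (hasDerivAt_inv h4Gne).comp_hasFDerivAt z hDen
    have hcomp1 := hNum.mul hinv
    have hpi : HasFDerivAt Φ (Φ' z) z := by
      rw [hasFDerivAt_pi']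
      intro i
      fin_cases i
      · refine (hA.congr_fderiv ?_).congr_of_eventuallyEq (Filter.Eventually.of_forall fun y => ?_)
        · ext w
          simp [hΦ'ap]
        · simp only [Fin.zero_eta, hΦ0]
      · refine (hcomp1.congr_fderiv ?_).congr_of_eventuallyEq (Filter.Eventually.of_forall fun y => ?_)
        · ext w
          simp [hΦ'ap, M11]
          field_simp
          ring
        · simp only [Fin.mk_one, hΦ1, Function.comp_apply, Pi.mul_apply, Pi.add_apply, Pi.sub_apply,
            div_eq_mul_inv]
    exact hpi.hasFDerivWithinAt
  · intro z₁ hz₁ z₂ hz₂ heq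
    have hz₁' : z₁ ∈ RMcap := by simpa [AngHMcap, KZ.IntegralRep.domain_restrict] using hz₁
    have hz₂' : z₂ ∈ RMcap := by simpa [AngHMcap, KZ.IntegralRep.domain_restrict] using hz₂
    have aV := RMcap_Q z₁ hz₁'
    have bV := RMcap_Q z₂ hz₂'
    have e0 : z₁ 0 = z₂ 0 := by
      have := congrFun heq 0
      simpa [Φ] using this
    have e1 : (1 + 2 * (4 * z₁ 1 - 2)) / (4 * (4 * z₁ 1 - 2)) = (1 + 2 * (4 * z₂ 1 - 2)) / (4 * (4 * z₂ 1 - 2)) := by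
      simpa [Φ] using congrFun heq 1
    have hD1 : (0:ℝ) < 4 * (4 * z₁ 1 - 2) := by linarith
    have hD2 : (0:ℝ) < 4 * (4 * z₂ 1 - 2) := by linarith
    rw [div_eq_div_iff hD1.ne' hD2.ne'] at e1
    have s1 : z₁ 1 = z₂ 1 := by linear_combination (-1/16 : ℝ) * e1
    funext i
    fin_cases i
    · exact e0
    · exact s1
  · intro z hz
    have hz' : z ∈ RMcap := by simpa [AngHMcap, KZ.IntegralRep.domain_restrict] using hz
    obtain ⟨h0, h1, r1, r2, r4, hV, hL⟩ := RMcap_facts z hz'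
    have hGp : (0:ℝ) < 4 * z 1 - 2 := by linarith [RMcap_Q z hz']
    have hGne : (4 * z 1 - 2) ≠ 0 := hGp.ne'
    have hneg : M11 z < 0 := by
      simp only [M11]
      exact div_neg_of_neg_of_pos (by norm_num) (mul_pos hGp hGp)
    rw [hdet z, abs_of_neg hneg]
    simp only [M11]
    simp only [AngHMcap, AngHMcapI, KZ.IntegralRep.integrand_restrict, RFun.rep_integrand]
    simp only [AngH, AngDen, RFun.fn, Φ, map_add, map_sub, map_mul, aeval_C, aeval_X, eq_ratCast, Rat.cast_one,
      Rat.cast_ofNat, vec2_0, vec2_1, Matrix.cons_val_zero, Matrix.cons_val_one, Matrix.head_cons]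
    have hQ' : 4 * ((1 + 2 * (4 * z 1 - 2)) / (4 * (4 * z 1 - 2))) - 2 = 1 / (4 * z 1 - 2) := by
      generalize hGG : 4 * z 1 - 2 = G at *
      field_simp
      ring
    rw [hQ']
    have h1ne : (1 + 4 * z 0 * z 0) ≠ 0 := (by nlinarith [mul_self_nonneg (z 0)] : (0:ℝ) < 1 + 4 * z 0 * z 0).ne'
    generalize hGG : 4 * z 1 - 2 = G at *
    have h2ne : (1 + G * G) ≠ 0 := (by nlinarith [mul_self_nonneg G] : (0:ℝ) < 1 + G * G).ne'
    have h3ne : (1 + 1 / G * (1 / G)) ≠ 0 := (by nlinarith [mul_self_nonneg (1 / G)] : (0:ℝ) < 1 + 1 / G * (1 / G)).ne'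
    field_simp
    ring

end Fold
end Summit.KontsevichZagierPeriods.RootDecompQuadraticDescent.Pair18Homotopy
end
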